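import Mathlib
import Literature.MathematicalPhysics.QuantumFieldTheory.Balaban1983to89.Beta.FluctuationProjection
import Literature.MathematicalPhysics.QuantumFieldTheory.Balaban1983to89.B5Prop11Lattice

/-!
# Road «FP», row IR-5′ (c′) — FILE F1: the LÖWNER SANDWICH `0 ≤ 𝒞 ≤ G ≤ γ₀⁻¹(Δ + 1)⁻¹` for b05's constrained
# one-shot covariance `𝒞 = 𝒫G` on every torus, and its quadratic-form consequences

Cell `pub-balaban`, β sub-cell, binder row D1, road «FP» (owner `b2b-balaban-beta-d1-p3`), lane (U2) IR-5′
(unit `b2b-balaban-beta-d1-formalise-leaf-05`, gen 17).  This is the first of the five modules of the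
m-UNIFORM SUP LETTER of the perfect ff block (lineage memo `FF-SUP-PLAN.md`; journal INTENT 2026-08-21T09:59Z):
the periodised ff block of the (j,m)-resolvent is `½M²N²·⟨f, 𝒞 f′⟩` (g15 `FP/CompositeCovarianceJunction`),
and this file bounds the quadratic form of `𝒞` by that of the free massive resolvent `(Δ + 1)⁻¹`.

## What this file certifies (kernel, [folklore] finite linear algebra over the tree's typed matrices)
* §1 (generic, any finite index type, `ℂ`): the LÖWNER-ANTITONE INVERSE for positive definite matrices,
  by the explicit identity `A⁻¹ − B⁻¹ = B⁻¹(B − A)B⁻¹ + (B⁻¹(B − A))·A⁻¹·(B⁻¹(B − A))ᴴ`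
  (`inv_sub_inv_posSemidef`: `A > 0`, `B − A ≥ 0` ⟹ `A⁻¹ − B⁻¹ ≥ 0`); the form version
  `re_form_inv_le` (with `B5Prop11Lower.form_re_nonneg_of_posSemidef` BY NAME); the POLARISATION bound `|Re x*Cy| ≤ ½(x*Cx + y*Cy)` for `C ≥ 0`
  (`abs_re_form_le_half_add`).
* §2 (b05's objects, every `n ≥ 1`, every coarse torus `M`, every `a > 0`): **`Cov_posSemidef`** —
  `𝒞 ≥ 0` from `𝒞 = 𝒞Δ_a𝒞 = 𝒞ᴴΔ_a𝒞` (`FluctuationProjection.Cov_mul_DeltaA_mul_Cov`, `Cov_conjTranspose`,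
  `B5DeltaA169.DeltaA_posDef`); **`calG_sub_Cov_eq`** — `G − 𝒞 = (1 − 𝒫)·G·(1 − 𝒫)ᴴ` from `𝒫² = 𝒫` and
  `𝒫G = G𝒫ᴴ` (no term-by-term analysis of (1.107)); hence **`calG_sub_Cov_posSemidef`** — `𝒞 ≤ G`.
* §3 **`calG_le_LapOne_inv`** — `G = Δ_a⁻¹ ≤ γ₀⁻¹·(Δ + 1)⁻¹`, `γ₀ = B5Prop11Lattice.gammaZero d a`, from
  the tree's KERNEL form of B5 Prop. 1.1 (1.90) `B5Prop11Lattice.ineq190 : γ₀•(Δ+1) ≤ Δ_a` and §1.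
* §4 the quadratic-form chain for every vector field `f`:
  `0 ≤ Re⟨f, 𝒞f⟩ ≤ Re⟨f, Gf⟩ ≤ γ₀⁻¹·Re⟨f, (Δ+1)⁻¹f⟩` (`re_form_Cov_nonneg`, `re_form_Cov_le_calG`,
  `re_form_calG_le`, `re_form_Cov_le`), and the off-diagonal bound `|Re⟨f, 𝒞g⟩| ≤ ½(Re⟨f,𝒞f⟩ + Re⟨g,𝒞g⟩)`
  (`abs_re_form_Cov_le`).

## HONEST SCOPE
(i) The ONLY B5 input is Prop. 1.1 (1.90) in its kernel form `ineq190` (proved in the tree for the typed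
operators; not a printed hypothesis).  (ii) `Δ = B5Prop11Lower.Lap n M = Σ_ν ∇_ν^*∇_ν` carries the lattice
factor `n = η⁻¹` inside `∇_ν`, so `(Δ + 1)⁻¹ = n⁻²·(L₁ + n⁻²)⁻¹` componentwise (the massive free resolvent of
files F2–F4 of this lineage).  (iii) Nothing here is an estimate of a CONSTRAINED object beyond `0 ≤ 𝒞 ≤ G`;
0∕4 row-D1 binders; NOT `hfar`, NOT `hRb`, NOT (ASYMP), NOT D1, NOT BetaPertH, NOT continuum, NOT Clay.
HONEST DEPENDENCY: continuum YM on T⁴ ⇐ BetaPertH ∧ nine spine estimates (0/9 proved); BetaPertH ⇐ (D1) ∧ (D4) ∧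
CAP+tail; G-an2-4 gates asym, D1 and NE2/3/4.
-/

noncomputable section

open scoped BigOperators Matrix ComplexConjugate ComplexOrder

namespace Summit.QuantumFields.BalabanUV.Beta.FP.CovarianceLoewnerSandwich

open Matrix
open Literature.MathematicalPhysics.QuantumFieldTheory.Balaban1983to89
open Literature.MathematicalPhysics.QuantumFieldTheory.Balaban1983to89.B5Prop11Plancherel
open Literature.MathematicalPhysics.QuantumFieldTheory.Balaban1983to89.B5Prop11Lower
open Literature.MathematicalPhysics.QuantumFieldTheory.Balaban1983to89.B5DeltaA169
open Literature.MathematicalPhysics.QuantumFieldTheory.Balaban1983to89.B5Prop11Lattice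
open Literature.MathematicalPhysics.QuantumFieldTheory.Balaban1983to89.Beta.FluctuationProjection

/-! ## §1 Generic: the Löwner-antitone inverse, forms, polarisation -/

section Generic

variable {m : Type*} [Fintype m] [DecidableEq m]

/-- the algebraic identity behind the antitone inverse: for invertible `A`, `B` with `B − A = D`,
`A⁻¹ − B⁻¹ = B⁻¹ D B⁻¹ + (B⁻¹ D) A⁻¹ (B⁻¹ D)ᴴ` provided `A`, `B`, `D` are Hermitian. [folklore] -/
theorem inv_sub_inv_eq {A B : Matrix m m ℂ} (hA : A.PosDef) (hB : B.PosDef) (hD : (B - A).IsHermitian) :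
    A⁻¹ - B⁻¹ = B⁻¹ * (B - A) * B⁻¹ + B⁻¹ * (B - A) * A⁻¹ * (B⁻¹ * (B - A))ᴴ := by
  have hAu : IsUnit A.det := (Matrix.isUnit_iff_isUnit_det _).mp hA.isUnit
  have hBu : IsUnit B.det := (Matrix.isUnit_iff_isUnit_det _).mp hB.isUnit
  have hAi : A⁻¹ * A = 1 := Matrix.nonsing_inv_mul A hAu
  have hAi' : A * A⁻¹ = 1 := Matrix.mul_nonsing_inv A hAu
  have hBi : B⁻¹ * B = 1 := Matrix.nonsing_inv_mul B hBu
  have hBi' : B * B⁻¹ = 1 := Matrix.mul_nonsing_inv B hBu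
  have hBh : (B⁻¹)ᴴ = B⁻¹ := hB.inv.isHermitian
  -- `(B⁻¹ D)ᴴ = D B⁻¹`
  have hct : (B⁻¹ * (B - A))ᴴ = (B - A) * B⁻¹ := by
    rw [Matrix.conjTranspose_mul, hBh, hD.eq]
  rw [hct]
  have e1 : (1 - B⁻¹ * A) * B⁻¹ = B⁻¹ - B⁻¹ * A * B⁻¹ := by rw [Matrix.sub_mul, Matrix.one_mul]
  have e2 : (1 - B⁻¹ * A) * A⁻¹ = A⁻¹ - B⁻¹ := by
    rw [Matrix.sub_mul, Matrix.one_mul, Matrix.mul_assoc, hAi', Matrix.mul_one]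
  have e3 : (A⁻¹ - B⁻¹) * (1 - A * B⁻¹) = A⁻¹ - B⁻¹ - B⁻¹ + B⁻¹ * A * B⁻¹ := by
    rw [Matrix.mul_sub, Matrix.mul_one, Matrix.sub_mul, ← Matrix.mul_assoc, hAi, Matrix.one_mul,
      ← Matrix.mul_assoc]
    abel
  have h1 : B⁻¹ * (B - A) = 1 - B⁻¹ * A := by rw [Matrix.mul_sub, hBi]
  have h2 : (B - A) * B⁻¹ = 1 - A * B⁻¹ := by rw [Matrix.sub_mul, hBi']
  rw [h1, h2, e1, e2, e3]
  abel

/-- **LÖWNER-ANTITONE INVERSE**: `0 < A`, `0 ≤ B − A` ⟹ `0 ≤ A⁻¹ − B⁻¹`. [folklore] -/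
theorem inv_sub_inv_posSemidef {A B : Matrix m m ℂ} (hA : A.PosDef) (hBA : (B - A).PosSemidef) :
    (A⁻¹ - B⁻¹).PosSemidef := by
  have hB : B.PosDef := by
    have := hA.add_posSemidef hBA
    simpa using this
  rw [inv_sub_inv_eq hA hB hBA.isHermitian]
  refine Matrix.PosSemidef.add ?_ ?_
  · have := hBA.conjTranspose_mul_mul_same B⁻¹
    rwa [hB.inv.isHermitian.eq] at this
  · exact hA.inv.posSemidef.mul_mul_conjTranspose_same (B⁻¹ * (B - A))

/-- form version: `0 < A ≤ B` ⟹ `Re x*B⁻¹x ≤ Re x*A⁻¹x`. [folklore] -/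
theorem re_form_inv_le {A B : Matrix m m ℂ} (hA : A.PosDef) (hBA : (B - A).PosSemidef) (x : m → ℂ) :
    (star x ⬝ᵥ (B⁻¹ *ᵥ x)).re ≤ (star x ⬝ᵥ (A⁻¹ *ᵥ x)).re := by
  have h := (inv_sub_inv_posSemidef hA hBA).dotProduct_mulVec_nonneg x
  rw [Matrix.sub_mulVec, dotProduct_sub] at h
  have := (Complex.le_def.mp h).1
  rw [Complex.zero_re, Complex.sub_re] at this
  linarith

omit [DecidableEq m] in
/-- `0 ≤ B − C` ⟹ `Re x*Cx ≤ Re x*Bx`. [folklore] -/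
theorem re_form_le_of_sub_posSemidef {B C : Matrix m m ℂ} (h : (B - C).PosSemidef) (x : m → ℂ) :
    (star x ⬝ᵥ (C *ᵥ x)).re ≤ (star x ⬝ᵥ (B *ᵥ x)).re := by
  have := form_re_nonneg_of_posSemidef h x
  rw [Matrix.sub_mulVec, dotProduct_sub, Complex.sub_re] at this
  linarith

omit [DecidableEq m] in
/-- for Hermitian `C`: `y*Cx = conj (x*Cy)`. [folklore] -/
theorem form_swap {C : Matrix m m ℂ} (hC : C.IsHermitian) (x y : m → ℂ) :
    star y ⬝ᵥ (C *ᵥ x) = conj (star x ⬝ᵥ (C *ᵥ y)) := by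
  rw [← Complex.star_def, star_dotProduct, star_mulVec, hC.eq, ← Matrix.dotProduct_mulVec]

omit [DecidableEq m] in
/-- POLARISATION for a positive semidefinite `C`: `|Re x*Cy| ≤ ½(Re x*Cx + Re y*Cy)`. [folklore] -/
theorem abs_re_form_le_half_add {C : Matrix m m ℂ} (hC : C.PosSemidef) (x y : m → ℂ) :
    |(star x ⬝ᵥ (C *ᵥ y)).re| ≤ ((star x ⬝ᵥ (C *ᵥ x)).re + (star y ⬝ᵥ (C *ᵥ y)).re) / 2 := by
  have hsw : (star y ⬝ᵥ (C *ᵥ x)).re = (star x ⬝ᵥ (C *ᵥ y)).re := by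
    rw [form_swap hC.isHermitian x y, Complex.conj_re]
  have hp := form_re_nonneg_of_posSemidef hC (x + y)
  have hm := form_re_nonneg_of_posSemidef hC (x - y)
  simp only [star_add, star_sub, Matrix.mulVec_add, Matrix.mulVec_sub, add_dotProduct, sub_dotProduct,
    dotProduct_add, dotProduct_sub, Complex.add_re, Complex.sub_re, hsw] at hp hm
  rw [abs_le]
  constructor <;> linarith

end Generic

/-! ## §2 b05's constrained covariance: `0 ≤ 𝒞 ≤ G` -/

section Torus

variable {d : ℕ} (n : ℕ) [NeZero n] (hn : 1 ≤ n) (M : Fin d → ℕ) [hM : ∀ μ, NeZero (M μ)] (a : ℝ)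
  (ha : 0 < a)

/-- **`𝒞 ≥ 0`**: `𝒞 = 𝒞ᴴ·Δ_a·𝒞` with `Δ_a > 0`. [folklore] -/
theorem Cov_posSemidef : (Cov n hn M a ha).PosSemidef := by
  have h := (DeltaA_posDef n hn M a ha).posSemidef.conjTranspose_mul_mul_same (Cov n hn M a ha)
  rwa [Cov_conjTranspose, Cov_mul_DeltaA_mul_Cov] at h

/-- **`G − 𝒞 = (1 − 𝒫)·G·(1 − 𝒫)ᴴ`** (`𝒫² = 𝒫`, `𝒫G = G𝒫ᴴ`). [folklore] -/
theorem calG_sub_Cov_eq :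
    calG n hn M a ha - Cov n hn M a ha
      = (1 - Pproj n hn M a ha) * calG n hn M a ha * (1 - Pproj n hn M a ha)ᴴ := by
  have hPG : Pproj n hn M a ha * calG n hn M a ha = calG n hn M a ha * (Pproj n hn M a ha)ᴴ :=
    Pproj_mul_calG_eq n hn M a ha
  have hPP : Pproj n hn M a ha * Pproj n hn M a ha = Pproj n hn M a ha := Pproj_mul_Pproj n hn M a ha
  rw [Matrix.conjTranspose_sub, Matrix.conjTranspose_one]
  simp only [Matrix.mul_sub, Matrix.sub_mul, Matrix.mul_one, Matrix.one_mul]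
  rw [Matrix.mul_assoc, ← hPG, ← Matrix.mul_assoc, hPP, Cov]
  abel

/-- **`𝒞 ≤ G`**: `G − 𝒞 ≥ 0`. [folklore] -/
theorem calG_sub_Cov_posSemidef : (calG n hn M a ha - Cov n hn M a ha).PosSemidef := by
  rw [calG_sub_Cov_eq]
  exact (calG_posDef n hn M a ha).posSemidef.mul_mul_conjTranspose_same _

/-! ## §3 `G ≤ γ₀⁻¹(Δ + 1)⁻¹` from (1.90) -/

/-- `Δ + 1 > 0`. [folklore] -/
theorem LapOne_posDef : (Lap n M + 1).PosDef := by
  have hL : (Lap n M).PosSemidef := by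
    rw [Lap]
    exact Matrix.posSemidef_sum _ fun ν _ => Matrix.posSemidef_conjTranspose_mul_self _
  exact Matrix.PosDef.posSemidef_add hL Matrix.PosDef.one

/-- `γ₀•(Δ + 1) > 0`. [folklore] -/
theorem smul_LapOne_posDef : (((gammaZero d a : ℝ) : ℂ) • (Lap n M + 1)).PosDef :=
  (LapOne_posDef n M).smul (Complex.zero_lt_real.mpr (gammaZero_pos d a))

/-- `(γ₀•(Δ+1))⁻¹ = γ₀⁻¹•(Δ+1)⁻¹`. [folklore] -/
theorem inv_smul_LapOne :
    (((gammaZero d a : ℝ) : ℂ) • (Lap n M + 1))⁻¹ = (((gammaZero d a)⁻¹ : ℝ) : ℂ) • (Lap n M + 1)⁻¹ := by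
  have hγ : ((gammaZero d a : ℝ) : ℂ) ≠ 0 := Complex.ofReal_ne_zero.mpr (gammaZero_pos d a).ne'
  have hu : IsUnit (Lap n M + 1).det := (Matrix.isUnit_iff_isUnit_det _).mp (LapOne_posDef n M).isUnit
  refine Matrix.inv_eq_left_inv ?_
  rw [Matrix.smul_mul, Matrix.mul_smul, Matrix.nonsing_inv_mul _ hu, smul_smul, Complex.ofReal_inv,
    inv_mul_cancel₀ hγ, one_smul]

/-- **`G − … ≥ 0` form of `G ≤ γ₀⁻¹(Δ + 1)⁻¹`**: `γ₀⁻¹•(Δ+1)⁻¹ − Δ_a⁻¹ ≥ 0`, from `ineq190`. [folklore] -/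
theorem calG_le_LapOne_inv :
    ((((gammaZero d a)⁻¹ : ℝ) : ℂ) • (Lap n M + 1)⁻¹ - calG n hn M a ha).PosSemidef := by
  have h190 := ineq190 n hn M a ha
  rw [Matrix.le_iff] at h190
  have h := inv_sub_inv_posSemidef (smul_LapOne_posDef n M a) h190
  rwa [inv_smul_LapOne, ← calG_eq_DeltaA_inv n hn M a ha] at h

/-! ## §4 The quadratic-form chain -/

/-- `0 ≤ Re⟨f, 𝒞f⟩`. [folklore] -/
theorem re_form_Cov_nonneg (f : Tor (fine n M) × Fin d → ℂ) :
    0 ≤ (star f ⬝ᵥ (Cov n hn M a ha *ᵥ f)).re :=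
  form_re_nonneg_of_posSemidef (Cov_posSemidef n hn M a ha) f

/-- `Re⟨f, 𝒞f⟩ ≤ Re⟨f, Gf⟩`. [folklore] -/
theorem re_form_Cov_le_calG (f : Tor (fine n M) × Fin d → ℂ) :
    (star f ⬝ᵥ (Cov n hn M a ha *ᵥ f)).re ≤ (star f ⬝ᵥ (calG n hn M a ha *ᵥ f)).re :=
  re_form_le_of_sub_posSemidef (calG_sub_Cov_posSemidef n hn M a ha) f

/-- `Re⟨f, Gf⟩ ≤ γ₀⁻¹·Re⟨f, (Δ+1)⁻¹f⟩`. [folklore] -/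
theorem re_form_calG_le (f : Tor (fine n M) × Fin d → ℂ) :
    (star f ⬝ᵥ (calG n hn M a ha *ᵥ f)).re
      ≤ (gammaZero d a)⁻¹ * (star f ⬝ᵥ ((Lap n M + 1)⁻¹ *ᵥ f)).re := by
  have h := re_form_le_of_sub_posSemidef (calG_le_LapOne_inv n hn M a ha) f
  rwa [Matrix.smul_mulVec, dotProduct_smul, smul_eq_mul, Complex.re_ofReal_mul] at h

/-- **THE CHAIN**: `Re⟨f, 𝒞f⟩ ≤ γ₀⁻¹·Re⟨f, (Δ+1)⁻¹f⟩`. [folklore] -/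
theorem re_form_Cov_le (f : Tor (fine n M) × Fin d → ℂ) :
    (star f ⬝ᵥ (Cov n hn M a ha *ᵥ f)).re
      ≤ (gammaZero d a)⁻¹ * (star f ⬝ᵥ ((Lap n M + 1)⁻¹ *ᵥ f)).re :=
  (re_form_Cov_le_calG n hn M a ha f).trans (re_form_calG_le n hn M a ha f)

/-- off-diagonal entries of the form: `|Re⟨f, 𝒞g⟩| ≤ ½(Re⟨f,𝒞f⟩ + Re⟨g,𝒞g⟩)`. [folklore] -/
theorem abs_re_form_Cov_le (f g : Tor (fine n M) × Fin d → ℂ) :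
    |(star f ⬝ᵥ (Cov n hn M a ha *ᵥ g)).re|
      ≤ ((star f ⬝ᵥ (Cov n hn M a ha *ᵥ f)).re + (star g ⬝ᵥ (Cov n hn M a ha *ᵥ g)).re) / 2 :=
  abs_re_form_le_half_add (Cov_posSemidef n hn M a ha) f g

/-- the off-diagonal bound joined with the chain: if `Re⟨f,(Δ+1)⁻¹f⟩ ≤ B` and `Re⟨g,(Δ+1)⁻¹g⟩ ≤ B` then
`|Re⟨f, 𝒞g⟩| ≤ γ₀⁻¹·B`. [folklore] -/
theorem abs_re_form_Cov_le_of_bounds (f g : Tor (fine n M) × Fin d → ℂ) {B : ℝ}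
    (hf : (star f ⬝ᵥ ((Lap n M + 1)⁻¹ *ᵥ f)).re ≤ B) (hg : (star g ⬝ᵥ ((Lap n M + 1)⁻¹ *ᵥ g)).re ≤ B) :
    |(star f ⬝ᵥ (Cov n hn M a ha *ᵥ g)).re| ≤ (gammaZero d a)⁻¹ * B := by
  have hγ : 0 ≤ (gammaZero d a)⁻¹ := inv_nonneg.mpr (gammaZero_pos d a).le
  have h1 := (re_form_Cov_le n hn M a ha f).trans (mul_le_mul_of_nonneg_left hf hγ)
  have h2 := (re_form_Cov_le n hn M a ha g).trans (mul_le_mul_of_nonneg_left hg hγ)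
  have h3 := abs_re_form_Cov_le n hn M a ha f g
  linarith

end Torus

end Summit.QuantumFields.BalabanUV.Beta.FP.CovarianceLoewnerSandwich
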